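import Summits.BirchSwinnertonDyer.BirchSwinnertonDyer.Theorems.PrintCf2SplitBadTwoTwistKernelTransport
import Summits.BirchSwinnertonDyer.BirchSwinnertonDyer.Theorems.PrintCf2SplitBadTwoKernelLineUpperBound
import Summits.BirchSwinnertonDyer.BirchSwinnertonDyer.Theorems.PrintCf2SplitBadTwoScalarSubOneSurjective
import Summits.BirchSwinnertonDyer.BirchSwinnertonDyer.Theorems.PrintCf2SplitBadTwoCMScalarAtVOfEtale
import Summits.BirchSwinnertonDyer.BirchSwinnertonDyer.Theorems.PrintCf2SplitBadTwoCMPrimaryGreenbergLine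
import HarnessLib

/-!
# Crux `PrintCf2.SplitBadTwoRankOneOfFacts` (stmt-BirchSwinnertonDyer-20368), road α v11.1, S3b′ brick (FIN) via (ET), piece (B1) COMPLETE at a
# pinned dyadic place: the transported kernel of reduction meets `E[2^∞]` exactly in the kernel line `W*′ = E[𝔮_{1−r}^∞]`

Cell `bsd-print-cf2`, EXTRA WIDTH seat `bsd-line-cf2-p1-w8` g3 (prover-bsd-line-cf2-p1-w8-g3-0); `--supports stmt-BirchSwinnertonDyer-20368`
(helper, Theses-free). HONEST FRAMING: nothing here closes the crux or a registered stub; BSD is not proved by any of this; no summit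
statement is proved by this seat. No definition, no named fact, no `sorry`, no kit. beyond-print theorem: no.

WHAT. **`exists_twistedReductionKernel_inter_torsion_eq_of_frame`** — on an S3c/S3b′ frame prefix (`C • W = cm7^{(d)}`, `d ≠ 0`; `K` imaginary
quadratic, `2 = v·v̄`; `π² = π − 2`, `r² = r − 2`; PINNING clause at `v` for `W* = E[𝔮_r^∞]`): there is a `Γ_{K_v}`-stable subgroup
`𝒦′ ≤ E_K(K̄_v)` with Greenberg's KUMMER COMPATIBILITY (`σP − P ∈ 𝒦′` for every `σ` in the inertia group of `K_v` fixing `√d` and every `P`) AND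
**`E[2^∞] ∩ 𝒦′ = W*′ = E[𝔮_{1−r}^∞]`** (a point of `E[2^∞](K̄)` maps into `𝒦′` iff it lies in the kernel line). This is (B1) of
TURNKEY-20368-ET-w3g10 §2 in full at the pinned place; consequently the Kummer cocycle `σ ↦ σR − R` (`2^n R = Q`) of the TWIST takes values in
`W*′` on the inertia of `K_v(√d)`, and its `W*`-component (`e` kills `W*′`) VANISHES there — the input of (B2).
Ingredients: p686370 `exists_twistedReductionKernel_of_frame` (𝒦′, Kummer, `T ∉ 𝒦′`); LOWER bound `W*′ ≤ 𝒞` by p686795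
`exists_sub_eq_of_scalar_ne_one` fed with the inertia element `σ₀ = τ₀²` (`τ₀` of -w2 g8 `exists_isFrobPow_zero_cyclotomicCharacter_ne`:
`χ(τ₀) ≠ ±1`, so `σ₀` fixes `√d` and acts on `W*′[2^k]` by `N ≡ ±χ(τ₀)² ≢ 1`, -w2 g8 p655423 `…isOrdinaryFiltrationDatum_of_pinned` clause (R));
UPPER bound by p686620 `le_of_compl_line_le_of_not_mem` (projector -w4 `exists_eigenProjector`, `W*[2]` cyclic by `endEigenPrimaryTorsion_two_structure`,
`T` pulled back to `E[2](K̄)` by `torsionPointsEquiv`).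
presearch: Greenberg LNM 1716 §2 Props. 2.2/2.4; Rubin LNM 1716 §3 Lemma 3.6 (ii), Cor. 3.17 — tree theorems; no new fact. playbook: none fit.

References: [GreenbergLNM1716] §2 pp. 62–63, 70–75; [Rubin1999] §2, §3 Lemma 3.6 (ii), Cor. 3.17; [SilvermanAEC2009] VII.2.1, X.5 Cor. 5.4.
-/

noncomputable section

open scoped Classical NNReal

set_option linter.dupNamespace false
set_option autoImplicit false

open NumberField IsDedekindDomain Field WeierstrassCurve
open Literature.NumberTheory.EllipticCurves Literature.NumberTheory.EllipticCurves.GreenbergSelmer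
open Literature.NumberTheory.GaloisRepresentations
open IsDedekindDomain.HeightOneSpectrum
open Summit.BirchSwinnertonDyer.BirchSwinnertonDyer.Theorems.PrintCf2.RestrictedSelmerPair
open Summit.BirchSwinnertonDyer.BirchSwinnertonDyer.Theorems.PrintCf2.AdditiveAtSeven
open Summit.BirchSwinnertonDyer.BirchSwinnertonDyer.Theorems.PrintCf2.CMPrimes

namespace Summit.BirchSwinnertonDyer.BirchSwinnertonDyer.Theorems.PrintCf2.ReductionKernel

variable {K : Type} [Field K] [NumberField K]

/-- In a subgroup whose `2`-torsion is the multiples of ONE element of order `2`, any two nonzero `2`-torsion elements coincide. [folklore] -/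
theorem eq_of_two_nsmul_eq_zero_of_zmultiples {A : Type*} [AddCommGroup A] (M : AddSubgroup A) {g : A} (hg : addOrderOf g = 2)
    (hM : M ⊓ AddSubgroup.torsionBy A (2 ^ 1 : ℕ) = AddSubgroup.zmultiples g) :
    ∀ a ∈ M, ∀ b ∈ M, 2 • a = 0 → 2 • b = 0 → a ≠ 0 → b ≠ 0 → a = b := by
  have hg2 : (2 : ℤ) • g = 0 := by
    rw [two_zsmul, ← two_nsmul, ← hg]; exact addOrderOf_nsmul_eq_zero g
  have key : ∀ a ∈ M, 2 • a = 0 → a ≠ 0 → a = g := by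
    intro a ha ha2 ha0
    have hmem : a ∈ M ⊓ AddSubgroup.torsionBy A (2 ^ 1 : ℕ) :=
      ⟨ha, by rw [pow_one]; exact AddSubgroup.torsionBy.nsmul_iff.mpr ha2⟩
    rw [hM, AddSubgroup.mem_zmultiples_iff] at hmem
    obtain ⟨k, rfl⟩ := hmem
    obtain ⟨c, hc | hc⟩ := Int.even_or_odd' k
    · exfalso; apply ha0
      rw [hc, mul_comm, mul_zsmul, hg2, zsmul_zero]
    · rw [hc, add_zsmul, one_zsmul, mul_comm, mul_zsmul, hg2, zsmul_zero, zero_add]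
  intro a ha b hb ha2 hb2 ha0 hb0
  rw [key a ha ha2 ha0, key b hb hb2 hb0]

/-- `−1` is not a square in `ℤ₂` (reduce modulo `4`). [folklore] -/
theorem sq_ne_neg_one_padicInt_two (x : ℤ_[2]) : x ^ 2 ≠ -1 := by
  intro h
  have h4 : ∀ y : ZMod 4, y ^ 2 ≠ -1 := by decide
  have := congrArg (PadicInt.toZModPow 2) h
  rw [map_pow, map_neg, map_one] at this
  exact h4 _ (by simpa using this)

/-- **(B1) AT THE PINNED PLACE: `E[2^∞] ∩ 𝒦′ = E[𝔮_{1−r}^∞]` for the transported kernel of reduction `𝒦′`, with Greenberg's Kummer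
compatibility.** See the module docstring. [cite: GreenbergLNM1716, §2 Props. 2.2 and 2.4] [cite: Rubin1999, §3 Lemma 3.6 (ii) and Cor. 3.17] -/
theorem exists_twistedReductionKernel_inter_torsion_eq_of_frame {d : ℤ} (hd0 : d ≠ 0) (W : WeierstrassCurve ℚ) [W.IsElliptic]
    (C : VariableChange ℚ) (hC : C • W = cm7.quadraticTwist (d : ℚ)) (hK : IsImaginaryQuadratic K)
    (v vbar : HeightOneSpectrum (𝓞 K)) (hv : ((2 : ℕ) : 𝓞 K) ∈ v.asIdeal) (hvbar : ((2 : ℕ) : 𝓞 K) ∈ vbar.asIdeal) (hne : vbar ≠ v)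
    (π : (W.baseChange K).endRing) (hrel : (π : AddMonoid.End (W.baseChange K).geomPoints) * π = π - 2) {r : ℤ_[2]} (hr : r * r = r - 2)
    (hpin : ∀ τ ∈ GreenbergSelmer.inertia v, ∀ x : ↥((W.baseChange K).endEigenPrimaryTorsion 2 π r), τ • x = x ∨ τ • x = -x) :
    ∃ 𝒦' : AddSubgroup (localPoints (W.baseChange K) (v.adicCompletion K)),
      (∀ (σ : absoluteGaloisGroup (v.adicCompletion K)) (P : localPoints (W.baseChange K) (v.adicCompletion K)), σ • P ∈ 𝒦' ↔ P ∈ 𝒦') ∧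
      (∀ σ ∈ absInertia (v.adicCompletion K),
        σ • geomSqrt (algebraMap K (v.adicCompletion K) (d : K)) = geomSqrt (algebraMap K (v.adicCompletion K) (d : K)) →
        ∀ P : localPoints (W.baseChange K) (v.adicCompletion K), σ • P - P ∈ 𝒦') ∧
      (∀ m : (W.baseChange K).geomPrimaryTorsion 2,
        pointsMap (W.baseChange K) (v.adicCompletion K) (m : (W.baseChange K).geomPoints) ∈ 𝒦' ↔
          m ∈ (W.baseChange K).endEigenPrimaryTorsion 2 π (1 - r)) := by
  haveI : Fact (Nat.Prime 2) := ⟨Nat.prime_two⟩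
  haveI : CharZero (v.adicCompletion K) := charZero_of_injective_algebraMap (algebraMap K (v.adicCompletion K)).injective
  -- frame supplies
  have hj : W.j = -3375 := j_eq_of_smul_eq_cm7Twist hd0 W C hC
  obtain ⟨θ, hθ⟩ := exists_sq_eq_neg_seven_of_cmEndo_mem_endRing W K hj π hrel
  have hf : v.asIdeal.inertiaDeg (𝓞 ℚ) = 1 := inertiaDeg_eq_one_of_ne_two K hK.1 hv hvbar hne
  obtain ⟨hinf, hsup⟩ := endEigenPrimaryTorsion_compl_of_frame hd0 W C hC K π hrel hr
  obtain ⟨e, -, -, he₃, -⟩ := exists_eigenProjector (W.baseChange K) 2 π r (1 - r) hinf hsup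
  have hr' : (1 - r) * (1 - r) = (1 - r) - 2 := by linear_combination hr
  obtain ⟨-, -, -, -, -, -, hgen, -⟩ := endEigenPrimaryTorsion_two_structure W hj K hθ π hrel hr
  obtain ⟨-, -, -, -, hdiv', -, -, -⟩ := endEigenPrimaryTorsion_two_structure W hj K hθ π hrel hr'
  -- `7 ∉ v` (since `2 ∈ v`)
  have hv7 : ((7 : ℤ) : 𝓞 K) ∉ v.asIdeal := by
    intro h7
    apply v.isPrime.ne_top
    rw [Ideal.eq_top_iff_one]
    have h2 : (2 : 𝓞 K) ∈ v.asIdeal := by exact_mod_cast hv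
    have : (1 : 𝓞 K) = ((7 : ℤ) : 𝓞 K) - 3 * 2 := by push_cast; norm_num
    rw [this]
    exact v.asIdeal.sub_mem h7 (v.asIdeal.mul_mem_left _ h2)
  -- the transported kernel of reduction at `v`
  obtain ⟨ν, hν⟩ := v.exists_spectralValuation
  obtain ⟨𝒦', hst, hkum, T, hT2, hT0, hT𝒦⟩ := exists_twistedReductionKernel_of_frame (w := v) hν hd0 W C hC hv7
  refine ⟨𝒦', hst, hkum, ?_⟩
  -- `𝒞 = E[2^∞] ∩ 𝒦′`
  set 𝒞 : AddSubgroup ((W.baseChange K).geomPrimaryTorsion 2) :=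
    𝒦'.comap ((pointsMap (W.baseChange K) (v.adicCompletion K)).comp ((W.baseChange K).geomPrimaryTorsion 2).subtype) with h𝒞
  have hmem𝒞 : ∀ m : (W.baseChange K).geomPrimaryTorsion 2, m ∈ 𝒞 ↔ pointsMap (W.baseChange K) (v.adicCompletion K) (m : (W.baseChange K).geomPoints) ∈ 𝒦' := fun m ↦ Iff.rfl
  -- the inertia element `σ₀ = τ₀²`
  obtain ⟨τ₀, hτ₀0, hτ₁, hτ₂⟩ := exists_isFrobPow_zero_cyclotomicCharacter_ne K v hv
  have hτ₀I : τ₀ ∈ absInertia (v.adicCompletion K) := isFrobPow_zero_iff_mem_absInertia.mp hτ₀0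
  set σ₀ : absoluteGaloisGroup (v.adicCompletion K) := τ₀ * τ₀ with hσ₀
  have hσ₀I : σ₀ ∈ absInertia (v.adicCompletion K) := Subgroup.mul_mem _ hτ₀I hτ₀I
  have hσ₀0 : IsFrobPow σ₀ 0 := isFrobPow_zero_iff_mem_absInertia.mpr hσ₀I
  have hσ₀fix : σ₀ • geomSqrt (algebraMap K (v.adicCompletion K) (d : K)) = geomSqrt (algebraMap K (v.adicCompletion K) (d : K)) := by
    rw [hσ₀, mul_smul]
    rcases map_geomSqrt (absoluteGaloisGroup.toAlgEquiv (v.adicCompletion K) τ₀) (algebraMap K (v.adicCompletion K) (d : K)) with h | h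
    · have h' : τ₀ • geomSqrt (algebraMap K (v.adicCompletion K) (d : K)) = geomSqrt (algebraMap K (v.adicCompletion K) (d : K)) := h
      rw [h', h']
    · have h' : τ₀ • geomSqrt (algebraMap K (v.adicCompletion K) (d : K)) = -geomSqrt (algebraMap K (v.adicCompletion K) (d : K)) := h
      rw [h', smul_neg, h', neg_neg]
  -- the local type (R) of the kernel line at `v`, for `σ₀` (Frobenius degree 0)
  have hcl : ∀ τ ∈ GreenbergSelmer.inertia v, ∀ x ∈ (W.baseChange K).endEigenPrimaryTorsion 2 π r, τ • x = x ∨ τ • x = -x :=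
    fun τ hτ x hx ↦ by
      rcases hpin τ hτ ⟨x, hx⟩ with h | h
      · exact Or.inl (congrArg Subtype.val h)
      · exact Or.inr (congrArg Subtype.val h)
  obtain ⟨α, -, -, hdat⟩ := endEigenPrimaryTorsion_two_isOrdinaryFiltrationDatum_of_pinned W K hj hθ π hrel hr v hv hf hcl
  obtain ⟨s₁, s₂, hs₁, -, -, hR⟩ := hdat σ₀ 0 hσ₀0
  set χ₀ : ℤ_[2]ˣ := GaloisRep.cyclotomicCharacter K 2 (absGaloisRestrict K (v.adicCompletion K) σ₀) with hχ₀
  set c₀ : ℤ_[2] := (s₁ : ℤ_[2]) * (χ₀ : ℤ_[2]) with hc₀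
  have hχ₀sq : (χ₀ : ℤ_[2]) = (GaloisRep.cyclotomicCharacter K 2 (absGaloisRestrict K (v.adicCompletion K) τ₀) : ℤ_[2]) ^ 2 := by
    rw [hχ₀, hσ₀, map_mul, map_mul, Units.val_mul, sq]
  have hc₀1 : c₀ ≠ 1 := by
    intro h1
    set χτ : ℤ_[2] := (GaloisRep.cyclotomicCharacter K 2 (absGaloisRestrict K (v.adicCompletion K) τ₀) : ℤ_[2]) with hχτ
    have hχτ1 : χτ ≠ 1 := fun h ↦ hτ₁ (Units.ext h)
    have hχτ2 : χτ ≠ -1 := fun h ↦ hτ₂ (Units.ext (by rw [Units.val_neg, Units.val_one]; exact h))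
    rw [hc₀, hχ₀sq] at h1
    rcases hs₁ with hs | hs <;> rw [hs] at h1
    · rw [Int.cast_one, one_mul] at h1
      have h1' : χτ * χτ = 1 := by rw [← sq]; exact h1
      rcases mul_self_eq_one_iff.mp h1' with h | h
      · exact hχτ1 h
      · exact hχτ2 h
    · rw [Int.cast_neg, Int.cast_one, neg_one_mul, neg_eq_iff_eq_neg] at h1
      exact sq_ne_neg_one_padicInt_two χτ h1
  -- `σ₀` acts on `W*′[2^k]` by scalars `≡ c₀`
  set f : (W.baseChange K).geomPrimaryTorsion 2 →+ (W.baseChange K).geomPrimaryTorsion 2 :=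
    AddMonoidHom.mk' (fun x ↦ absGaloisRestrict K (v.adicCompletion K) σ₀ • x) (smul_add _) with hfdef
  have hscalar : ∀ (k : ℕ), ∀ x ∈ (W.baseChange K).endEigenPrimaryTorsion 2 π (1 - r), 2 ^ k • x = 0 →
      ∀ N : ℤ, ((N : ℤ_[2]) - c₀) ∈ (Ideal.span {(2 : ℤ_[2]) ^ k} : Ideal ℤ_[2]) → f x = N • x := by
    intro k x hx hxk N hN
    rw [hfdef, AddMonoidHom.mk'_apply]
    refine hR k x hx hxk N ?_
    have : ((χ₀ * (α⁻¹) ^ (0 : ℕ) : ℤ_[2]ˣ) : ℤ_[2]) = (χ₀ : ℤ_[2]) := by rw [pow_zero, mul_one]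
    rw [this, ← hc₀]
    exact hN
  -- LOWER bound: `W*′ ≤ 𝒞`
  have hprim : ∀ y ∈ (W.baseChange K).endEigenPrimaryTorsion 2 π (1 - r), ∃ k : ℕ, 2 ^ k • y = 0 := fun y _ ↦ by
    obtain ⟨k, hk⟩ := (AddCommGroup.mem_primaryComponent (G := (W.baseChange K).geomPoints)).mp y.2
    exact ⟨k, Subtype.ext (by rw [AddSubmonoidClass.coe_nsmul, hk, ZeroMemClass.coe_zero])⟩
  have hlow : (W.baseChange K).endEigenPrimaryTorsion 2 π (1 - r) ≤ 𝒞 := by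
    intro y hy
    obtain ⟨x, -, hxy⟩ := exists_sub_eq_of_scalar_ne_one (p := 2) ((W.baseChange K).endEigenPrimaryTorsion 2 π (1 - r)) hprim hdiv' f hc₀1 hscalar y hy
    rw [hmem𝒞, ← hxy, hfdef, AddMonoidHom.mk'_apply, AddSubgroupClass.coe_sub, map_sub, primaryComponent.coe_smul,
      ← resGal_eq_absGaloisRestrict, pointsMap_smul]
    exact hkum σ₀ hσ₀I hσ₀fix _
  -- the `2`-torsion point `T ∉ 𝒦′`, pulled back to `E[2](K̄)`
  have h20 : ((2 : ℕ) : ℤ) ≠ 0 := by norm_num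
  have hTmem : T ∈ AddSubgroup.torsionBy (localPoints (W.baseChange K) (v.adicCompletion K)) ((2 : ℕ) : ℤ) :=
    AddSubgroup.torsionBy.nsmul_iff.mpr hT2
  set TK : (W.baseChange K).geomTorsion ((2 : ℕ) : ℤ) := ((W.baseChange K).torsionPointsEquiv ((2 : ℕ) : ℤ) (E := (v.adicCompletion K)) h20).symm ⟨T, hTmem⟩ with hTK
  have hTKmap : pointsMap (W.baseChange K) (v.adicCompletion K) (TK : (W.baseChange K).geomPoints) = T := (W.baseChange K).pointsMap_torsionPointsEquiv_symm _ h20 _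
  have hTK2 : 2 • (TK : (W.baseChange K).geomPoints) = 0 := by
    have h := ((W.baseChange K).mem_geomTorsion_iff ((2 : ℕ) : ℤ) (TK : (W.baseChange K).geomPoints)).mp TK.2
    rwa [natCast_zsmul] at h
  set TP : (W.baseChange K).geomPrimaryTorsion 2 := ⟨(TK : (W.baseChange K).geomPoints), (AddCommGroup.mem_primaryComponent).mpr ⟨1, by rw [pow_one]; exact hTK2⟩⟩
    with hTP
  have hTP2 : 2 • TP = 0 := Subtype.ext (by rw [AddSubmonoidClass.coe_nsmul, ZeroMemClass.coe_zero]; exact hTK2)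
  have hTP𝒞 : TP ∉ 𝒞 := by rw [hmem𝒞]; change pointsMap (W.baseChange K) (v.adicCompletion K) (TK : (W.baseChange K).geomPoints) ∉ 𝒦'; rw [hTKmap]; exact hT𝒦
  -- `W*[2]` has one nonzero element
  obtain ⟨g, -, hord, hzm⟩ := hgen 1
  have hM2 := eq_of_two_nsmul_eq_zero_of_zmultiples ((W.baseChange K).endEigenPrimaryTorsion 2 π r) (by rw [hord, pow_one]) hzm
  -- UPPER bound and conclusion
  have hA : ∀ x : (W.baseChange K).geomPrimaryTorsion 2, ∃ j : ℕ, 2 ^ j • x = 0 := fun x ↦ by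
    obtain ⟨k, hk⟩ := (AddCommGroup.mem_primaryComponent (G := (W.baseChange K).geomPoints)).mp x.2
    exact ⟨k, Subtype.ext (by rw [AddSubmonoidClass.coe_nsmul, hk, ZeroMemClass.coe_zero])⟩
  have hup : 𝒞 ≤ (W.baseChange K).endEigenPrimaryTorsion 2 π (1 - r) :=
    le_of_compl_line_le_of_not_mem hA ((W.baseChange K).endEigenPrimaryTorsion 2 π r) ((W.baseChange K).endEigenPrimaryTorsion 2 π (1 - r)) 𝒞 e he₃ hM2 hlow hTP2 hTP𝒞
  intro m
  rw [← hmem𝒞]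
  exact ⟨fun hm ↦ hup hm, fun hm ↦ hlow hm⟩

end Summit.BirchSwinnertonDyer.BirchSwinnertonDyer.Theorems.PrintCf2.ReductionKernel

end
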